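import Summits.PneNP.PneNP.Theses.ConvexRankGates
import Summits.PneNP.PneNP.Theorems.ConvexRankGatesCaptureDefs
import Literature.Computability.Complexity.CircuitComposition
import HarnessLib

/-!
# Route ConvexRankGates, crux `Capture` (stmt-PneNP-2659), line `csp-spine-meet-to-join`: the residual stub

Two kernel-checked facts about the line's declared RESIDUAL, Stub 4 `stub_captureModSpine` of the skeleton
`Summits/PneNP/PneNP/Cruxes/Capture/Lines/csp_spine_meet_to_join.lean` ("Capture modulo the spine": the crux
`Capture` verbatim with the target basis enlarged from `extGate` to `spineGate = extGate ∪ LC ∪ LIN ∪ COSET`,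
vocabulary of `Theorems/ConvexRankGatesCaptureDefs.lean`), recorded in the tree for the planner who promotes
or re-lines it:

* `capture_imp_captureModSpine` — the residual is WEAKER than the crux: `Capture → CaptureModSpine` (same
  simulating circuit; `extGate S ⊆ spineGate S`). With the landed Stubs 1, 2, 3a and the open Stub 3b it is
  equivalent to the crux (`Capture_of` in the skeleton), so it is not a strengthening in costume.
* `captureModSpine_false_without_monotone` — the residual keeps the hypothesis `Monotone f` for cause:
  dropping it makes the statement false (`x ↦ ¬x₀` has a `B₂`-circuit of size `1` and no circuit over any
  spine basis, every spine gate being monotone by syntax — `spineGate_monotone`), the analogue of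
  Disproof §1 `capture_false_without_Monotone` for the enlarged basis.

Lead prover-line-stmt-PneNP-2659-0, 2026-08-16. [folklore]
-/

namespace Summit.PneNP.PneNP.Cruxes.Capture.CspSpineMeetToJoin

set_option linter.dupNamespace false -- `Summit.PneNP.PneNP.…`: summit = sub-problem (D-0017)

open Literature.Computability.Complexity

/-- **The residual is weaker than the crux**: `Capture → CaptureModSpine` — a circuit over
`extGate S` is a circuit over `spineGate S ⊇ extGate S` (the crux's inline `Ext` is `extGate` up to
unfolding, `mem_extGate_iff`). Registered sub-goal `capture_imp_captureModSpine` of the skeleton. -/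
theorem capture_imp_captureModSpine : Summit.PneNP.PneNP.Theses.ConvexRankGates.Capture →
    ∃ a : ℕ, ∀ (ι : Type) (_ : Fintype ι) (f : (ι → Bool) → Bool), Monotone f →
      ∀ C : Circuit ι, C.IsOver B2 → C.Computes f →
        ∃ C' : Circuit ι, C'.IsOver (spineGate ((C.size + Fintype.card ι + 2) ^ a)) ∧
          C'.size ≤ (C.size + Fintype.card ι + 2) ^ a ∧ C'.Computes f := by
  rintro ⟨a, hcap⟩
  refine ⟨a, fun ι _ f hf C hB2 hcomp => ?_⟩
  obtain ⟨C', hover, hsize, hcomp'⟩ := hcap ι inferInstance f hf C hB2 hcomp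
  refine ⟨C', fun g hg => extGate_subset_spineGate _ (mem_extGate_iff.2 ?_), hsize, hcomp'⟩
  exact hover g hg

/-- **The residual keeps the hypothesis `Monotone f`**: without it `CaptureModSpine` is false —
`x ↦ ¬x₀` has a `B₂`-circuit of size `1` (`cktSize_not`) but every circuit over a spine basis computes
a monotone function (`monotone_eval_of_isOver_spineGate`). -/
theorem captureModSpine_false_without_monotone :
    ¬ ∃ a : ℕ, ∀ (ι : Type) (_ : Fintype ι) (f : (ι → Bool) → Bool),
      ∀ C : Circuit ι, C.IsOver B2 → C.Computes f →
        ∃ C' : Circuit ι, C'.IsOver (spineGate ((C.size + Fintype.card ι + 2) ^ a)) ∧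
          C'.size ≤ (C.size + Fintype.card ι + 2) ^ a ∧ C'.Computes f := by
  rintro ⟨a, h⟩
  obtain ⟨C, hCB, -, hCev⟩ := (cktSize_not (ι := Fin 1) (0 : Fin 1)).toCircuit
  obtain ⟨C', hC'over, -, hC'comp⟩ := h (Fin 1) inferInstance (fun x => !(x 0)) C hCB
    (fun x => hCev x)
  have hmono : Monotone (fun x : Fin 1 → Bool => !(x 0)) := by
    intro x y hxy
    rw [← hC'comp x, ← hC'comp y]
    exact monotone_eval_of_isOver_spineGate C' hC'over hxy
  exact not_monotone_bnot_apply (0 : Fin 1) hmono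

end Summit.PneNP.PneNP.Cruxes.Capture.CspSpineMeetToJoin
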